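import Literature.NumberTheory.Sieve.BombieriAsymptoticSievePrProductLaw
import Literature.NumberTheory.Sieve.RoughOmegaCellsAsymptoticDensity
import Literature.NumberTheory.LFunctions.PrimeCountingThetaRatio
import Mathlib.Analysis.PSeries
import HarnessLib
/-!
# Bombieri's asymptotic sieve on `P_r`: comparison with the integers and the rough cells

Topic `Literature/NumberTheory/Sieve`, family `parity`. Proof file (no named fact, no `Prop`
definition), second step on the road from the tree's PROVED vector Theorem 1
(`Bombieri1976_asymptotic_sieve_vector`) to `Bombieri1976_PrDistributionMin`
([BombieriRIMS1977] p. 5 Theorem, every `r`); first step: `BombieriAsymptoticSievePrProductLaw.lean`.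

## Main results (all under the hypothesis `hV : Bombieri1976_asymptotic_sieve_vector`, a theorem of the
tree, `Bombieri1976_asymptotic_sieve_vector_holds`)

* `BombieriPr.cmp_poly`, `BombieriPr.cmp_cont` — **comparison with the integers**: for a Bombieri
  sequence `A` (density constant `H`) and a product weight `W_r(n) = ∏_{p ∣ n} r(log p/log x)` with `r`
  a polynomial divisible by `t²`, resp. `r = t² κ` with `κ` continuous on `[0, 1]`,
  `∑_{n ∈ P_s(x)} a_n W_r(n) = ρ_s(x) ∑_{n ∈ P_s(x)} W_r(n) + o(A(x)/log x)`,
  `ρ_s(x) = M_s(A; x)/M_s(ℤ; x)` (`M_s` = `BombieriRoughCells.mainTerm`, `ℤ` = the sequence `a_n ≡ 1`,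
  `SieveSequence.integers`): the constant `J(s, h)` of the polynomial law cancels, and continuous
  weights follow by Weierstrass approximation of `κ` and the Chebyshev bound `primeProd_log_le`.
* `BombieriPr.roughCell_integers` — Alladi's theorem (tree, `exists_abs_roughCell_sub_main_le`) in the
  format of `BombieriRoughCells.roughCell`: `#{n ≤ x : n ∈ P_s, p_min(n) ≥ x^{1/V}} = I_s(V) x/log x + o(x/log x)`.
* `BombieriPr.roughCell_law` — **the rough cells of a Bombieri sequence**, unconditionally on the
  tree's theorems: `C_s(x, V) = I_s(V) M_s(x) + o(A(x)/log x)` for `s ≥ 1`, `V > 1` (sandwich of the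
  sharp cell between ramp product weights, comparison with the integers, Alladi for the integers,
  the prime number theorem `M_s(ℤ; x) ∼ x/log x`, continuity of `I_s`, and `δ_x ≤ 2 + o(1)`).
-/

noncomputable section

open Filter Asymptotics Finset ArithmeticFunction
open scoped Topology ArithmeticFunction.omega ArithmeticFunction.Omega

namespace Literature.NumberTheory.Sieve

open BombieriVector BombieriP2 BombieriRoughCells

namespace BombieriPr

/-! ### The main term of the integers: `M_s(ℤ; x) ∼ x/log x` -/

/-- For the integers, `∑_{p ≤ x} a_p = π(⌊x⌋)`. [folklore] -/
theorem primeSum_integers (x : ℝ) :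
    ∑ p ∈ Nat.primesLE ⌊x⌋₊, SieveSequence.integers.a p = (Nat.primeCounting ⌊x⌋₊ : ℝ) := by
  simp only [SieveSequence.integers_a, Finset.sum_const, nsmul_eq_mul, mul_one,
    Nat.primesLE_card_eq_primeCounting]

/-- **`M_s(ℤ; x) log x/x → 1`** (prime number theorem; `⌊x⌋/x → 1`). [folklore] -/
theorem tendsto_mainTerm_integers (s : ℕ) :
    Tendsto (fun x : ℝ => mainTerm SieveSequence.integers 1 s x * Real.log x / x) atTop (𝓝 1) := by
  have hπ := Literature.NumberTheory.LFunctions.tendsto_primeCounting_mul_log_div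
  have hfl : Tendsto (fun x : ℝ => (⌊x⌋₊ : ℝ) / x) atTop (𝓝 1) :=
    tendsto_nat_floor_div_atTop
  -- `M_s(ℤ;x) log x / x = (1 + (-1)^s) ⌊x⌋/x − (−1)^s π(⌊x⌋) log x/x` for `x > 1`
  have hlim : Tendsto (fun x : ℝ => (1 + (-1 : ℝ) ^ s) * ((⌊x⌋₊ : ℝ) / x) -
      (-1 : ℝ) ^ s * ((Nat.primeCounting ⌊x⌋₊ : ℝ) * Real.log x / x)) atTop (𝓝 1) := by
    have h := (hfl.const_mul (1 + (-1 : ℝ) ^ s)).sub (hπ.const_mul ((-1 : ℝ) ^ s))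
    have he : (1 + (-1 : ℝ) ^ s) * 1 - (-1 : ℝ) ^ s * 1 = 1 := by ring
    rwa [he] at h
  refine hlim.congr' ?_
  filter_upwards [eventually_gt_atTop (1 : ℝ)] with x hx1
  have hL : Real.log x ≠ 0 := (Real.log_pos hx1).ne'
  have hx : x ≠ 0 := by linarith
  rw [mainTerm, primeSum_integers, SieveSequence.integers_size]
  field_simp

/-- **`M_s(ℤ; x) ≥ x/(2 log x)` for large `x`**. [folklore] -/
theorem mainTerm_integers_ge :
    ∀ s : ℕ, ∀ᶠ x : ℝ in atTop, x / (2 * Real.log x) ≤ mainTerm SieveSequence.integers 1 s x := by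
  intro s
  have h := (tendsto_mainTerm_integers s).eventually (Ioi_mem_nhds (show (1 : ℝ) / 2 < 1 by norm_num))
  filter_upwards [h, eventually_gt_atTop (1 : ℝ)] with x hx hx1
  have hL : 0 < Real.log x := Real.log_pos hx1
  have hx0 : 0 < x := by linarith
  rw [lt_div_iff₀ hx0] at hx
  rw [div_le_iff₀ (by positivity)]
  nlinarith

/-- **`M_s(ℤ; x) > 0` for large `x`**. [folklore] -/
theorem mainTerm_integers_pos (s : ℕ) :
    ∀ᶠ x : ℝ in atTop, 0 < mainTerm SieveSequence.integers 1 s x := by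
  filter_upwards [mainTerm_integers_ge s, eventually_gt_atTop (1 : ℝ)] with x hx hx1
  exact lt_of_lt_of_le (by have := Real.log_pos hx1; positivity) hx

/-! ### The main term of a Bombieri sequence: size and sign -/

/-- `|M_s(A; x)| ≤ K₃ A(x)/log x` for large `x`. [folklore] -/
theorem abs_mainTerm_eventually {A : SieveSequence} {H : ℝ} (hA : A.IsBombieriSequence)
    (hH : A.HasDensityConstant H) (s : ℕ) :
    ∃ K₃ : ℝ, 0 ≤ K₃ ∧ ∀ᶠ x : ℝ in atTop, |mainTerm A H s x| ≤ K₃ * A.size x / Real.log x := by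
  have hH0 : 0 ≤ H := SieveSequence.HasDensityConstant.nonneg_of_bombieriA1 hH hA.2.1
  obtain ⟨K, hK0, hK⟩ := chebyshev_primeCount hA hH
  refine ⟨2 * H + K, by positivity, ?_⟩
  filter_upwards [hK, eventually_gt_atTop (1 : ℝ)] with x hxK hx1
  exact abs_mainTerm_le hH0 hA.1 s hx1 hxK

/-- **`δ_x ≤ 2 + o(1)`**: `M_s(A; x) ≥ −ε A(x)/log x` for large `x` (for odd `s`, `M_s = ∑_{p ≤ x} a_p ≥ 0`;
for even `s`, `∑_{p ≤ x} a_p (log p)² ≤ ∑_{n ≤ x} a_n Λ₂(n) ∼ 2 H A(x) log x` and the `P₁` partial summation).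
[folklore] -/
theorem mainTerm_ge {A : SieveSequence} {H : ℝ} (hA : A.IsBombieriSequence)
    (hH : A.HasDensityConstant H) (s : ℕ) {ε : ℝ} (hε : 0 < ε) :
    ∀ᶠ x : ℝ in atTop, -(ε * (A.size x / Real.log x)) ≤ mainTerm A H s x := by
  have hXnn : ∀ y, 0 ≤ A.size y := SieveSequence.size_nonneg_of_size_eq hA.1
  have hH0 : 0 ≤ H := SieveSequence.HasDensityConstant.nonneg_of_bombieriA1 hH hA.2.1
  rcases Nat.even_or_odd s with hs | hs
  · -- even `s`: `M_s = 2 H A/log x − ∑ a_p`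
    have hT := (Bombieri1976_asymptotic_sieve_holds A H hA hH 2 le_rfl).isLittleO.def
      (show 0 < ε / (4 * (H + 1)) by positivity)
    have hD := (primes_powlog_defect_isLittleO hA hH (k := 2) (by norm_num)).def
      (show 0 < ε / 2 by positivity)
    filter_upwards [hT, hD, eventually_gt_atTop (1 : ℝ)] with x hxT hxD hx1
    have hL : 0 < Real.log x := Real.log_pos hx1
    have e2 : (2 : ℕ) - 1 = 1 := rfl
    have h2H : 0 ≤ 2 * H * A.size x * Real.log x :=
      mul_nonneg (mul_nonneg (mul_nonneg zero_le_two hH0) (hXnn x)) hL.le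
    simp only [Pi.sub_apply, e2, pow_one, Nat.cast_ofNat] at hxT
    rw [Real.norm_eq_abs, Real.norm_eq_abs, abs_of_nonneg h2H] at hxT
    rw [e2, pow_one, Real.norm_eq_abs, Real.norm_eq_abs,
      abs_of_nonneg (mul_nonneg (hXnn x) hL.le)] at hxD
    -- `∑ a_p (log p)² ≤ ∑ a_n Λ₂(n)`
    have hP2 : ∑ p ∈ Nat.primesLE ⌊x⌋₊, A.a p * Real.log p ^ 2 ≤
        ∑ n ∈ Ioc 0 ⌊x⌋₊, generalizedVonMangoldt 2 n * A.a n := by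
      calc ∑ p ∈ Nat.primesLE ⌊x⌋₊, A.a p * Real.log p ^ 2
          = ∑ p ∈ Nat.primesLE ⌊x⌋₊, generalizedVonMangoldt 2 p * A.a p :=
            Finset.sum_congr rfl fun p hp => by
              rw [BombieriSieve.SelbergFormula.generalizedVonMangoldt_two_prime
                (Nat.prime_of_mem_primesLE hp)]; ring
        _ ≤ _ := by
            refine Finset.sum_le_sum_of_subset_of_nonneg (fun p hp => ?_) fun n _ _ =>
              mul_nonneg (generalizedVonMangoldt_nonneg 2 n) (A.a_nonneg n)
            have h := Nat.mem_primesLE.mp hp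
            exact Finset.mem_Ioc.mpr ⟨h.2.pos, h.1⟩
    have h1 := (abs_le.mp hxT).2
    have h2 := (abs_le.mp hxD).2
    have hHfrac : ε / (4 * (H + 1)) * (2 * H) ≤ ε / 2 := by
      rw [div_mul_eq_mul_div, div_le_div_iff₀ (by positivity) (by positivity)]
      nlinarith
    have hAL : 0 ≤ A.size x * Real.log x := mul_nonneg (hXnn x) hL.le
    have h1' : ∑ n ∈ Ioc 0 ⌊x⌋₊, generalizedVonMangoldt 2 n * A.a n - 2 * H * A.size x * Real.log x ≤
        ε / 2 * (A.size x * Real.log x) :=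
      h1.trans (by
        calc ε / (4 * (H + 1)) * (2 * H * A.size x * Real.log x)
            = (ε / (4 * (H + 1)) * (2 * H)) * (A.size x * Real.log x) := by ring
          _ ≤ ε / 2 * (A.size x * Real.log x) := mul_le_mul_of_nonneg_right hHfrac hAL)
    have hsum : ∑ p ∈ Nat.primesLE ⌊x⌋₊, A.a p * (Real.log x ^ 2 - Real.log p ^ 2) =
        Real.log x ^ 2 * (∑ p ∈ Nat.primesLE ⌊x⌋₊, A.a p) -
          ∑ p ∈ Nat.primesLE ⌊x⌋₊, A.a p * Real.log p ^ 2 := by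
      rw [Finset.mul_sum, ← Finset.sum_sub_distrib]
      exact Finset.sum_congr rfl fun p _ => by ring
    rw [hsum] at h2
    have hs1 : (-1 : ℝ) ^ s = 1 := hs.neg_one_pow
    rw [mainTerm, hs1]
    -- `log²x · P ≤ 2 H A log x + ε A log x`
    have hkey : Real.log x ^ 2 * (∑ p ∈ Nat.primesLE ⌊x⌋₊, A.a p) ≤
        2 * H * A.size x * Real.log x + ε * (A.size x * Real.log x) := by linarith
    have hkey' : (∑ p ∈ Nat.primesLE ⌊x⌋₊, A.a p) ≤ 2 * H * A.size x / Real.log x +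
        ε * (A.size x / Real.log x) := by
      rw [show 2 * H * A.size x / Real.log x + ε * (A.size x / Real.log x) =
        (2 * H * A.size x * Real.log x + ε * (A.size x * Real.log x)) / Real.log x ^ 2 by
          field_simp]
      rw [le_div_iff₀ (by positivity)]
      linarith
    norm_num
    linarith
  · have hs1 : (-1 : ℝ) ^ s = -1 := hs.neg_one_pow
    filter_upwards [eventually_gt_atTop (1 : ℝ)] with x hx1
    have hL : 0 < Real.log x := Real.log_pos hx1
    rw [mainTerm, hs1]
    norm_num
    have h0 : 0 ≤ ∑ p ∈ Nat.primesLE ⌊x⌋₊, A.a p := primeSum_nonneg A x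
    have h1 : 0 ≤ ε * (A.size x / Real.log x) := by have := hXnn x; positivity
    linarith

/-! ### Comparison with the integers for polynomial product weights -/

/-- `|ρ_s(x)| ≤ 2K₃ A(x)/x` for large `x`, whence `ρ_s = O(A(x)/x)`. [folklore] -/
theorem abs_mainTerm_div_le {A : SieveSequence} {H : ℝ} (hA : A.IsBombieriSequence)
    (hH : A.HasDensityConstant H) (s : ℕ) :
    ∃ C : ℝ, 0 ≤ C ∧ ∀ᶠ x : ℝ in atTop, |(mainTerm A H s x / mainTerm SieveSequence.integers 1 s x)| ≤ C * (A.size x / x) := by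
  obtain ⟨K₃, hK₃0, hK₃⟩ := abs_mainTerm_eventually hA hH s
  refine ⟨2 * K₃, by positivity, ?_⟩
  filter_upwards [hK₃, mainTerm_integers_ge s, eventually_gt_atTop (1 : ℝ)] with x hxK hxM hx1
  have hL : 0 < Real.log x := Real.log_pos hx1
  have hx0 : 0 < x := by linarith
  have hM0 : 0 < mainTerm SieveSequence.integers 1 s x := lt_of_lt_of_le (by positivity) hxM
  have hXnn : 0 ≤ A.size x := SieveSequence.size_nonneg_of_size_eq hA.1 x
  rw [abs_div, abs_of_pos hM0, div_le_iff₀ hM0]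
  calc |mainTerm A H s x| ≤ K₃ * A.size x / Real.log x := hxK
    _ = 2 * K₃ * (A.size x / x) * (x / (2 * Real.log x)) := by field_simp
    _ ≤ 2 * K₃ * (A.size x / x) * mainTerm SieveSequence.integers 1 s x :=
        mul_le_mul_of_nonneg_left hxM (by positivity)

/-- **Comparison with the integers, polynomial weights**: for `h(t) = ∑_{2 ≤ a ≤ K} c_a t^a`,
`∑_{n ∈ P_s(x)} a_n W_h(n) = ρ_s(x) ∑_{n ∈ P_s(x)} W_h(n) + o(A(x)/log x)` — the constant `J(s, h)` of
`productLaw_poly` is the same for `A` and for the integers, and cancels. [folklore] -/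
theorem cmp_poly (hV : Bombieri1976_asymptotic_sieve_vector) {A : SieveSequence} {H : ℝ}
    (hA : A.IsBombieriSequence) (hH : A.HasDensityConstant H) {s : ℕ} (hs : 1 ≤ s)
    (c : ℕ → ℝ) (K : ℕ) :
    (fun x : ℝ => ∑ n ∈ Ps s x, A.a n * ∏ p ∈ n.primeFactors, hpoly c K (Real.log p / Real.log x) -
        (mainTerm A H s x / mainTerm SieveSequence.integers 1 s x) * ∑ n ∈ Ps s x, ∏ p ∈ n.primeFactors, hpoly c K (Real.log p / Real.log x))
      =o[atTop] fun x : ℝ => A.size x / Real.log x := by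
  obtain ⟨J, hJ⟩ := productLaw_poly hV hs c K
  have hXnn : ∀ y, 0 ≤ A.size y := SieveSequence.size_nonneg_of_size_eq hA.1
  have hA' := hJ A H hA hH
  have hI' := hJ SieveSequence.integers 1 SieveSequence.integers_isBombieriSequence
    SieveSequence.hasDensityConstant_integers
  simp only [SieveSequence.integers_a, one_mul, SieveSequence.integers_size] at hI'
  obtain ⟨C, hC0, hC⟩ := abs_mainTerm_div_le hA hH s
  have hρ : (fun x : ℝ => mainTerm A H s x / mainTerm SieveSequence.integers 1 s x) =O[atTop] fun x : ℝ => A.size x / x := by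
    refine IsBigO.of_bound C ?_
    filter_upwards [hC, eventually_gt_atTop (0 : ℝ)] with x hx hx0
    rwa [Real.norm_eq_abs, Real.norm_eq_abs, abs_of_nonneg (div_nonneg (hXnn x) hx0.le)]
  have h2 : (fun x : ℝ => (mainTerm A H s x / mainTerm SieveSequence.integers 1 s x) *
      (∑ n ∈ Ps s x, ∏ p ∈ n.primeFactors, hpoly c K (Real.log p / Real.log x) -
        J * mainTerm SieveSequence.integers 1 s x)) =o[atTop] fun x : ℝ => A.size x / Real.log x := by
    refine (hρ.mul_isLittleO hI').trans_isBigO (IsBigO.of_bound 1 ?_)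
    filter_upwards [eventually_gt_atTop (1 : ℝ)] with x hx1
    have hL : 0 < Real.log x := Real.log_pos hx1
    have hx0 : 0 < x := by linarith
    have hfl : (⌊x⌋₊ : ℝ) ≤ x := Nat.floor_le hx0.le
    rw [one_mul, Real.norm_eq_abs, Real.norm_eq_abs, abs_of_nonneg (div_nonneg (hXnn x) hL.le),
      abs_of_nonneg (mul_nonneg (div_nonneg (hXnn x) hx0.le) (div_nonneg (Nat.cast_nonneg _) hL.le))]
    calc A.size x / x * (⌊x⌋₊ / Real.log x) = A.size x / Real.log x * (⌊x⌋₊ / x) := by ring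
      _ ≤ A.size x / Real.log x * 1 :=
          mul_le_mul_of_nonneg_left ((div_le_one hx0).mpr hfl) (div_nonneg (hXnn x) hL.le)
      _ = _ := mul_one _
  refine (hA'.sub h2).congr' ?_ EventuallyEq.rfl
  filter_upwards [mainTerm_integers_pos s] with x hM
  field_simp
  ring

/-! ### An elementary bound for differences of products -/

/-- `|∏ f − ∏ g| ≤ ∑_i δ_i ∏_{j ≠ i} b_j` when `|f_i − g_i| ≤ δ_i`, `|f_i|, |g_i| ≤ b_i`. [folklore] -/
theorem abs_prod_sub_prod_le {ι : Type*} [DecidableEq ι] (S : Finset ι) {f g b δ : ι → ℝ}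
    (hfg : ∀ i ∈ S, |f i - g i| ≤ δ i) (hf : ∀ i ∈ S, |f i| ≤ b i) (hg : ∀ i ∈ S, |g i| ≤ b i) :
    |∏ i ∈ S, f i - ∏ i ∈ S, g i| ≤ ∑ i ∈ S, δ i * ∏ j ∈ S.erase i, b j := by
  induction S using Finset.induction_on with
  | empty => simp
  | insert a S ha ih =>
    have hb : ∀ i ∈ S, 0 ≤ b i := fun i hi => (abs_nonneg _).trans (hf i (Finset.mem_insert_of_mem hi))
    have hδ : ∀ i ∈ S, 0 ≤ δ i := fun i hi => (abs_nonneg _).trans (hfg i (Finset.mem_insert_of_mem hi))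
    have ih' := ih (fun i hi => hfg i (Finset.mem_insert_of_mem hi))
      (fun i hi => hf i (Finset.mem_insert_of_mem hi)) (fun i hi => hg i (Finset.mem_insert_of_mem hi))
    rw [Finset.prod_insert ha, Finset.prod_insert ha, Finset.sum_insert ha, Finset.erase_insert ha]
    have hsplit : f a * ∏ i ∈ S, f i - g a * ∏ i ∈ S, g i =
        f a * (∏ i ∈ S, f i - ∏ i ∈ S, g i) + (f a - g a) * ∏ i ∈ S, g i := by ring
    rw [hsplit]
    have hga : |∏ i ∈ S, g i| ≤ ∏ i ∈ S, b i := by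
      rw [Finset.abs_prod]
      exact Finset.prod_le_prod (fun i _ => abs_nonneg _) fun i hi => hg i (Finset.mem_insert_of_mem hi)
    have hrest : ∑ i ∈ S, δ i * ∏ j ∈ (insert a S).erase i, b j =
        b a * ∑ i ∈ S, δ i * ∏ j ∈ S.erase i, b j := by
      rw [Finset.mul_sum]
      refine Finset.sum_congr rfl fun i hi => ?_
      have hne : a ≠ i := fun h => ha (h ▸ hi)
      rw [Finset.erase_insert_of_ne hne, Finset.prod_insert (fun h => ha (Finset.mem_of_mem_erase h))]
      ring
    rw [hrest]
    calc |f a * (∏ i ∈ S, f i - ∏ i ∈ S, g i) + (f a - g a) * ∏ i ∈ S, g i|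
        ≤ |f a| * |∏ i ∈ S, f i - ∏ i ∈ S, g i| + |f a - g a| * |∏ i ∈ S, g i| := by
          refine (abs_add_le _ _).trans ?_
          rw [abs_mul, abs_mul]
      _ ≤ b a * (∑ i ∈ S, δ i * ∏ j ∈ S.erase i, b j) + δ a * ∏ i ∈ S, b i := by
          refine add_le_add (mul_le_mul (hf a (Finset.mem_insert_self a S)) ih' (abs_nonneg _)
            ((abs_nonneg _).trans (hf a (Finset.mem_insert_self a S)))) ?_
          exact mul_le_mul (hfg a (Finset.mem_insert_self a S)) hga (abs_nonneg _)
            ((abs_nonneg _).trans (hfg a (Finset.mem_insert_self a S)))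
      _ = δ a * ∏ i ∈ S, b i + b a * ∑ i ∈ S, δ i * ∏ j ∈ S.erase i, b j := by ring

/-- The product-difference bound for product weights over the prime factors of `n ∈ P_s(x)`:
if `|h(t) − r(t)| ≤ ε t²` and `|h(t)|, |r(t)| ≤ B t` on `[0, 1]` (`B ≥ 0`), then
`|W_h(n) − W_r(n)| ≤ ε s B^{s−1} ∏_{p∣n} (log p/log x)`. [folklore] -/
theorem abs_primeProd_sub_le {h r : ℝ → ℝ} {ε B : ℝ} (hε : 0 ≤ ε) (hB : 0 ≤ B)
    (hhr : ∀ t ∈ Set.Icc (0 : ℝ) 1, |h t - r t| ≤ ε * t ^ 2)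
    (hh : ∀ t ∈ Set.Icc (0 : ℝ) 1, |h t| ≤ B * t) (hr : ∀ t ∈ Set.Icc (0 : ℝ) 1, |r t| ≤ B * t)
    {s : ℕ} {x : ℝ} (hx : 1 < x) {n : ℕ} (hn : n ∈ Ps s x) :
    |∏ p ∈ n.primeFactors, h (Real.log p / Real.log x) - ∏ p ∈ n.primeFactors, r (Real.log p / Real.log x)| ≤
      ε * s * B ^ (s - 1) * ∏ p ∈ n.primeFactors, (Real.log p / Real.log x) := by
  obtain ⟨⟨hn1, hnN⟩, _, hcard⟩ := mem_Ps.mp hn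
  have hx0 : 0 < x := by linarith
  have hL : 0 < Real.log x := Real.log_pos hx
  have hnx : (n : ℝ) ≤ x := (Nat.cast_le.mpr hnN).trans (Nat.floor_le hx0.le)
  set v : ℕ → ℝ := fun p => Real.log p / Real.log x with hv
  have hv01 : ∀ p ∈ n.primeFactors, v p ∈ Set.Icc (0 : ℝ) 1 := by
    intro p hp
    have hp' := Nat.prime_of_mem_primeFactors hp
    have hpn : (p : ℝ) ≤ n := by exact_mod_cast Nat.le_of_dvd hn1 (Nat.dvd_of_mem_primeFactors hp)
    refine ⟨div_nonneg (Real.log_nonneg (by exact_mod_cast hp'.one_lt.le)) hL.le, ?_⟩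
    rw [hv, div_le_one hL]
    exact Real.log_le_log (by exact_mod_cast hp'.pos) (hpn.trans hnx)
  have key := abs_prod_sub_prod_le n.primeFactors (f := fun p => h (v p)) (g := fun p => r (v p))
    (b := fun p => B * v p) (δ := fun p => ε * v p ^ 2)
    (fun p hp => hhr _ (hv01 p hp)) (fun p hp => hh _ (hv01 p hp)) (fun p hp => hr _ (hv01 p hp))
  refine key.trans ?_
  have hterm : ∀ p ∈ n.primeFactors, ε * v p ^ 2 * ∏ q ∈ n.primeFactors.erase p, B * v q ≤
      ε * B ^ (s - 1) * ∏ q ∈ n.primeFactors, v q := by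
    intro p hp
    rw [Finset.prod_mul_distrib, Finset.prod_const, Finset.card_erase_of_mem hp, hcard]
    have hvp := hv01 p hp
    have hP0 : 0 ≤ ∏ q ∈ n.primeFactors.erase p, v q :=
      Finset.prod_nonneg fun q hq => (hv01 q (Finset.mem_of_mem_erase hq)).1
    calc ε * v p ^ 2 * (B ^ (s - 1) * ∏ q ∈ n.primeFactors.erase p, v q)
        = ε * B ^ (s - 1) * (v p * (v p * ∏ q ∈ n.primeFactors.erase p, v q)) := by ring
      _ = ε * B ^ (s - 1) * (v p * ∏ q ∈ n.primeFactors, v q) := by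
          rw [Finset.mul_prod_erase _ _ hp]
      _ ≤ ε * B ^ (s - 1) * (1 * ∏ q ∈ n.primeFactors, v q) := by
          refine mul_le_mul_of_nonneg_left (mul_le_mul_of_nonneg_right hvp.2 ?_) (by positivity)
          exact Finset.prod_nonneg fun q hq => (hv01 q hq).1
      _ = ε * B ^ (s - 1) * ∏ q ∈ n.primeFactors, v q := by rw [one_mul]
  calc ∑ p ∈ n.primeFactors, ε * v p ^ 2 * ∏ q ∈ n.primeFactors.erase p, B * v q
      ≤ ∑ p ∈ n.primeFactors, ε * B ^ (s - 1) * ∏ q ∈ n.primeFactors, v q := Finset.sum_le_sum hterm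
    _ = ε * s * B ^ (s - 1) * ∏ p ∈ n.primeFactors, v p := by
        rw [Finset.sum_const, hcard, nsmul_eq_mul]; ring

end BombieriPr

end Literature.NumberTheory.Sieve


namespace Literature.NumberTheory.Sieve

open BombieriVector BombieriP2 BombieriRoughCells

namespace BombieriPr

/-! ### Comparison with the integers for continuous product weights -/

/-- `t² q(t) = hpoly c K t` with `c a = q.coeff (a − 2)`, `K = natDegree q + 2`. [folklore] -/
theorem sq_mul_eval_eq_hpoly (q : Polynomial ℝ) (t : ℝ) :
    t ^ 2 * q.eval t = hpoly (fun a => q.coeff (a - 2)) (q.natDegree + 2) t := by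
  rw [hpoly, Polynomial.eval_eq_sum_range, Finset.mul_sum]
  have hI : Finset.Icc 2 (q.natDegree + 2) = Finset.Ico 2 (q.natDegree + 3) := by
    ext a; simp only [Finset.mem_Icc, Finset.mem_Ico]; omega
  rw [hI, Finset.sum_Ico_eq_sum_range, show q.natDegree + 3 - 2 = q.natDegree + 1 by omega]
  refine Finset.sum_congr rfl fun i _ => ?_
  rw [show 2 + i - 2 = i by omega, pow_add]
  ring

/-- **Comparison with the integers, continuous weights**: for `r = t² κ` on `[0, 1]` with `κ`
continuous on `[0, 1]`, `∑_{n ∈ P_s(x)} a_n W_r(n) = ρ_s(x) ∑_{n ∈ P_s(x)} W_r(n) + o(A(x)/log x)`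
(Weierstrass approximation of `κ`, `cmp_poly`, and the Chebyshev bound `primeProd_log_le` for `A` and
for the integers). [folklore] -/
theorem cmp_cont (hV : Bombieri1976_asymptotic_sieve_vector) {A : SieveSequence} {H : ℝ}
    (hA : A.IsBombieriSequence) (hH : A.HasDensityConstant H) {s : ℕ} (hs : 1 ≤ s) {r κ : ℝ → ℝ}
    (hκ : ContinuousOn κ (Set.Icc 0 1)) (hr : ∀ t ∈ Set.Icc (0 : ℝ) 1, r t = t ^ 2 * κ t) :
    (fun x : ℝ => ∑ n ∈ Ps s x, A.a n * ∏ p ∈ n.primeFactors, r (Real.log p / Real.log x) -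
        (mainTerm A H s x / mainTerm SieveSequence.integers 1 s x) * ∑ n ∈ Ps s x, ∏ p ∈ n.primeFactors, r (Real.log p / Real.log x))
      =o[atTop] fun x : ℝ => A.size x / Real.log x := by
  have hXnn : ∀ y, 0 ≤ A.size y := SieveSequence.size_nonneg_of_size_eq hA.1
  obtain ⟨B, hB⟩ := isCompact_Icc.exists_bound_of_continuousOn hκ
  set B₀ : ℝ := max B 0 with hB₀
  have hB₀0 : 0 ≤ B₀ := le_max_right _ _
  have hκB : ∀ t ∈ Set.Icc (0 : ℝ) 1, |κ t| ≤ B₀ := fun t ht =>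
    (Real.norm_eq_abs (κ t) ▸ hB t ht).trans (le_max_left _ _)
  obtain ⟨CA, hCA0, hCA⟩ := primeProd_log_le hV hA hH hs
  obtain ⟨CI, hCI0, hCI⟩ := primeProd_log_le hV SieveSequence.integers_isBombieriSequence
    SieveSequence.hasDensityConstant_integers hs
  obtain ⟨Cρ, hCρ0, hCρ⟩ := abs_mainTerm_div_le hA hH s
  rw [isLittleO_iff]
  intro c hc
  set D : ℝ := s * (B₀ + 1) ^ (s - 1) * (CA + Cρ * CI) + 1 with hD
  have hD0 : 0 < D := by positivity
  set ε₁ : ℝ := min 1 (c / 2 / D) with hε₁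
  have hε₁0 : 0 < ε₁ := lt_min one_pos (by positivity)
  have hε₁1 : ε₁ ≤ 1 := min_le_left _ _
  have hε₁D : ε₁ * D ≤ c / 2 := by
    have := min_le_right 1 (c / 2 / D)
    rwa [← hε₁, le_div_iff₀ hD0] at this
  obtain ⟨q, hq⟩ := exists_polynomial_near_of_continuousOn 0 1 κ hκ ε₁ hε₁0
  set c' : ℕ → ℝ := fun a => q.coeff (a - 2) with hc'
  set K : ℕ := q.natDegree + 2 with hK
  have hhq : ∀ t, hpoly c' K t = t ^ 2 * q.eval t := fun t => (sq_mul_eval_eq_hpoly q t).symm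
  -- pointwise bounds on `[0, 1]`
  have hh_r : ∀ t ∈ Set.Icc (0 : ℝ) 1, |hpoly c' K t - r t| ≤ ε₁ * t ^ 2 := by
    intro t ht
    rw [hhq, hr t ht, ← mul_sub, abs_mul, abs_of_nonneg (sq_nonneg t), mul_comm]
    exact mul_le_mul_of_nonneg_right (le_of_lt (hq t ht)) (sq_nonneg t)
  have ht2 : ∀ t ∈ Set.Icc (0 : ℝ) 1, t ^ 2 ≤ t := fun t ht => by
    have : t * t ≤ 1 * t := mul_le_mul_of_nonneg_right ht.2 ht.1
    rwa [one_mul, ← sq] at this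
  have hr_b : ∀ t ∈ Set.Icc (0 : ℝ) 1, |r t| ≤ (B₀ + 1) * t := by
    intro t ht
    rw [hr t ht, abs_mul, abs_of_nonneg (sq_nonneg t)]
    calc t ^ 2 * |κ t| ≤ t * (B₀ + 1) :=
          mul_le_mul (ht2 t ht) ((hκB t ht).trans (by linarith)) (abs_nonneg _) ht.1
      _ = (B₀ + 1) * t := mul_comm _ _
  have hh_b : ∀ t ∈ Set.Icc (0 : ℝ) 1, |hpoly c' K t| ≤ (B₀ + 1) * t := by
    intro t ht
    have hqt : |q.eval t| ≤ B₀ + 1 := by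
      have h1 : |q.eval t - κ t| < ε₁ := hq t ht
      have h2 := hκB t ht
      have := abs_sub_abs_le_abs_sub (q.eval t) (κ t)
      linarith
    rw [hhq, abs_mul, abs_of_nonneg (sq_nonneg t)]
    calc t ^ 2 * |q.eval t| ≤ t * (B₀ + 1) := mul_le_mul (ht2 t ht) hqt (abs_nonneg _) ht.1
      _ = (B₀ + 1) * t := mul_comm _ _
  have hpc := (cmp_poly hV hA hH hs c' K).def (half_pos hc)
  filter_upwards [hpc, hCA, hCI, hCρ, eventually_gt_atTop (1 : ℝ)] with x hxp hxA hxI hxρ hx1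
  have hx0 : 0 < x := by linarith
  have hL : 0 < Real.log x := Real.log_pos hx1
  set L := Real.log x with hLdef
  rw [Real.norm_eq_abs, Real.norm_eq_abs, abs_of_nonneg (div_nonneg (hXnn x) hL.le)] at hxp ⊢
  -- the two approximation errors
  have hb0 : 0 ≤ B₀ + 1 := by linarith
  have hdiffA : |∑ n ∈ Ps s x, A.a n * ∏ p ∈ n.primeFactors, hpoly c' K (Real.log p / L) -
      ∑ n ∈ Ps s x, A.a n * ∏ p ∈ n.primeFactors, r (Real.log p / L)| ≤
      ε₁ * s * (B₀ + 1) ^ (s - 1) * (CA * A.size x / L) := by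
    rw [← Finset.sum_sub_distrib]
    refine (Finset.abs_sum_le_sum_abs _ _).trans ?_
    calc ∑ n ∈ Ps s x, |A.a n * ∏ p ∈ n.primeFactors, hpoly c' K (Real.log p / L) -
          A.a n * ∏ p ∈ n.primeFactors, r (Real.log p / L)|
        ≤ ∑ n ∈ Ps s x, A.a n * (ε₁ * s * (B₀ + 1) ^ (s - 1) *
            ∏ p ∈ n.primeFactors, (Real.log p / L)) := by
          refine Finset.sum_le_sum fun n hn => ?_
          rw [← mul_sub, abs_mul, abs_of_nonneg (A.a_nonneg n)]
          exact mul_le_mul_of_nonneg_left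
            (abs_primeProd_sub_le hε₁0.le hb0 hh_r hh_b hr_b hx1 hn) (A.a_nonneg n)
      _ = ε₁ * s * (B₀ + 1) ^ (s - 1) *
            ∑ n ∈ Ps s x, A.a n * ∏ p ∈ n.primeFactors, (Real.log p / L) := by
          rw [Finset.mul_sum]; exact Finset.sum_congr rfl fun n _ => by ring
      _ ≤ ε₁ * s * (B₀ + 1) ^ (s - 1) * (CA * A.size x / L) :=
          mul_le_mul_of_nonneg_left hxA (by positivity)
  have hdiffI : |∑ n ∈ Ps s x, ∏ p ∈ n.primeFactors, hpoly c' K (Real.log p / L) -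
      ∑ n ∈ Ps s x, ∏ p ∈ n.primeFactors, r (Real.log p / L)| ≤
      ε₁ * s * (B₀ + 1) ^ (s - 1) * (CI * x / L) := by
    rw [← Finset.sum_sub_distrib]
    refine (Finset.abs_sum_le_sum_abs _ _).trans ?_
    simp only [SieveSequence.integers_a, one_mul, SieveSequence.integers_size] at hxI
    calc ∑ n ∈ Ps s x, |∏ p ∈ n.primeFactors, hpoly c' K (Real.log p / L) -
          ∏ p ∈ n.primeFactors, r (Real.log p / L)|
        ≤ ∑ n ∈ Ps s x, ε₁ * s * (B₀ + 1) ^ (s - 1) * ∏ p ∈ n.primeFactors, (Real.log p / L) :=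
          Finset.sum_le_sum fun n hn => abs_primeProd_sub_le hε₁0.le hb0 hh_r hh_b hr_b hx1 hn
      _ = ε₁ * s * (B₀ + 1) ^ (s - 1) * ∑ n ∈ Ps s x, ∏ p ∈ n.primeFactors, (Real.log p / L) := by
          rw [Finset.mul_sum]
      _ ≤ ε₁ * s * (B₀ + 1) ^ (s - 1) * (CI * ⌊x⌋₊ / L) := mul_le_mul_of_nonneg_left hxI (by positivity)
      _ ≤ ε₁ * s * (B₀ + 1) ^ (s - 1) * (CI * x / L) := by
          refine mul_le_mul_of_nonneg_left ?_ (by positivity)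
          exact div_le_div_of_nonneg_right (mul_le_mul_of_nonneg_left (Nat.floor_le hx0.le) hCI0) hL.le
  -- combine
  have hρ : |(mainTerm A H s x / mainTerm SieveSequence.integers 1 s x)| ≤ Cρ * (A.size x / x) := hxρ
  set SAh := ∑ n ∈ Ps s x, A.a n * ∏ p ∈ n.primeFactors, hpoly c' K (Real.log p / L)
  set SAr := ∑ n ∈ Ps s x, A.a n * ∏ p ∈ n.primeFactors, r (Real.log p / L)
  set SIh := ∑ n ∈ Ps s x, ∏ p ∈ n.primeFactors, hpoly c' K (Real.log p / L)
  set SIr := ∑ n ∈ Ps s x, ∏ p ∈ n.primeFactors, r (Real.log p / L)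
  set ρ := (mainTerm A H s x / mainTerm SieveSequence.integers 1 s x)
  have hsplit : SAr - ρ * SIr = (SAr - SAh) + (SAh - ρ * SIh) + ρ * (SIh - SIr) := by ring
  rw [hsplit]
  have h3 : |ρ * (SIh - SIr)| ≤ Cρ * (A.size x / x) * (ε₁ * s * (B₀ + 1) ^ (s - 1) * (CI * x / L)) := by
    rw [abs_mul]
    exact mul_le_mul hρ hdiffI (abs_nonneg _) (mul_nonneg hCρ0 (div_nonneg (hXnn x) hx0.le))
  calc |SAr - SAh + (SAh - ρ * SIh) + ρ * (SIh - SIr)|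
      ≤ |SAr - SAh| + |SAh - ρ * SIh| + |ρ * (SIh - SIr)| := abs_add_three _ _ _
    _ ≤ ε₁ * s * (B₀ + 1) ^ (s - 1) * (CA * A.size x / L) + c / 2 * (A.size x / L) +
          Cρ * (A.size x / x) * (ε₁ * s * (B₀ + 1) ^ (s - 1) * (CI * x / L)) := by
        refine add_le_add (add_le_add ?_ hxp) h3
        rwa [abs_sub_comm]
    _ = (ε₁ * (s * (B₀ + 1) ^ (s - 1) * (CA + Cρ * CI)) + c / 2) * (A.size x / L) := by
        field_simp
        ring
    _ ≤ (ε₁ * D + c / 2) * (A.size x / L) := by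
        refine mul_le_mul_of_nonneg_right (add_le_add (mul_le_mul_of_nonneg_left ?_ hε₁0.le) le_rfl)
          (div_nonneg (hXnn x) hL.le)
        rw [hD]; linarith
    _ ≤ c * (A.size x / L) := by
        refine mul_le_mul_of_nonneg_right ?_ (div_nonneg (hXnn x) hL.le)
        linarith

/-! ### Ramps as `t² κ(t)` -/

/-- For `a > 0` the ramp `ramp a θ` is of the form `t² κ(t)` on `[0, 1]` with `κ = ramp/t²` continuous.
[folklore] -/
theorem continuousOn_ramp_div_sq {a θ : ℝ} (ha : 0 < a) (hθ : 0 < θ) :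
    ContinuousOn (fun t : ℝ => ramp a θ t / t ^ 2) (Set.Icc 0 1) := by
  intro t _
  refine ContinuousAt.continuousWithinAt ?_
  rcases lt_or_ge t a with h | h
  · have hev : (fun t : ℝ => ramp a θ t / t ^ 2) =ᶠ[𝓝 t] fun _ => 0 := by
      filter_upwards [Iio_mem_nhds h] with u hu
      rw [ramp_eq_zero hθ (le_of_lt hu), zero_div]
    exact (continuousAt_const.congr hev.symm)
  · have ht0 : t ≠ 0 := by intro h0; rw [h0] at h; linarith
    exact (continuous_ramp a θ).continuousAt.div (continuousAt_id.pow 2) (pow_ne_zero 2 ht0)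

/-- `ramp a θ t = t² · (ramp a θ t/t²)` on `[0, 1]` (`a ≥ 0`, `θ > 0`). [folklore] -/
theorem ramp_eq_sq_mul {a θ : ℝ} (ha : 0 ≤ a) (hθ : 0 < θ) (t : ℝ) :
    ramp a θ t = t ^ 2 * (ramp a θ t / t ^ 2) := by
  rcases eq_or_ne t 0 with rfl | ht
  · rw [ramp_eq_zero hθ ha]; simp
  · field_simp

/-! ### Product weights of `[0,1]`-valued functions and the sharp cells -/

/-- `0 ≤ W_r(n)` for `r ≥ 0`. [folklore] -/
theorem primeProd_nonneg {r : ℝ → ℝ} (hr0 : ∀ t, 0 ≤ r t) (x : ℝ) (n : ℕ) :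
    0 ≤ ∏ p ∈ n.primeFactors, r (Real.log p / Real.log x) :=
  Finset.prod_nonneg fun _ _ => hr0 _

/-- `W_r(n) ≤ 1` for `0 ≤ r ≤ 1`. [folklore] -/
theorem primeProd_le_one {r : ℝ → ℝ} (hr0 : ∀ t, 0 ≤ r t) (hr1 : ∀ t, r t ≤ 1) (x : ℝ) (n : ℕ) :
    ∏ p ∈ n.primeFactors, r (Real.log p / Real.log x) ≤ 1 :=
  Finset.prod_le_one (fun _ _ => hr0 _) fun _ _ => hr1 _

/-- **Upper sandwich**: if `r ≥ 0` and `r(t) = 1` for `t ≥ 1/V`, the sharp cell indicator is at most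
`W_r(n)` (`x > 1`). [folklore] -/
theorem cellInd_le_primeProd {r : ℝ → ℝ} (hr0 : ∀ t, 0 ≤ r t) {V : ℝ} (hr1 : ∀ t, 1 / V ≤ t → r t = 1)
    {x : ℝ} (hx : 1 < x) (n : ℕ) :
    (if x ^ (1 / V) ≤ (Nat.minFac n : ℝ) then (1 : ℝ) else 0) ≤
      ∏ p ∈ n.primeFactors, r (Real.log p / Real.log x) := by
  split_ifs with h
  · have hx0 : 0 < x := by linarith
    have hL : 0 < Real.log x := Real.log_pos hx
    refine le_of_eq (Finset.prod_eq_one fun p hp => (hr1 _ ?_)).symm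
    have hp' := Nat.prime_of_mem_primeFactors hp
    have hmin : (Nat.minFac n : ℝ) ≤ p := by
      exact_mod_cast Nat.minFac_le_of_dvd hp'.two_le (Nat.dvd_of_mem_primeFactors hp)
    rw [le_div_iff₀ hL, ← Real.log_rpow hx0]
    exact Real.log_le_log (Real.rpow_pos_of_pos hx0 _) (h.trans hmin)
  · exact primeProd_nonneg hr0 x n

/-- **Lower sandwich**: if `0 ≤ r ≤ 1` and `r(t) = 0` for `t ≤ 1/V`, then `W_r(n)` is at most the sharp
cell indicator, for `n ≥ 2`, `x > 1`. [folklore] -/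
theorem primeProd_le_cellInd {r : ℝ → ℝ} (hr0 : ∀ t, 0 ≤ r t) (hr1 : ∀ t, r t ≤ 1) {V : ℝ}
    (hrz : ∀ t, t ≤ 1 / V → r t = 0) {x : ℝ} (hx : 1 < x) {n : ℕ} (hn : 2 ≤ n) :
    ∏ p ∈ n.primeFactors, r (Real.log p / Real.log x) ≤
      if x ^ (1 / V) ≤ (Nat.minFac n : ℝ) then (1 : ℝ) else 0 := by
  split_ifs with h
  · exact primeProd_le_one hr0 hr1 x n
  · have hx0 : 0 < x := by linarith
    have hL : 0 < Real.log x := Real.log_pos hx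
    have hmf : Nat.minFac n ∈ n.primeFactors :=
      Nat.mem_primeFactors.mpr ⟨Nat.minFac_prime (by omega), Nat.minFac_dvd n, by omega⟩
    refine le_of_eq (Finset.prod_eq_zero hmf (hrz _ ?_))
    have hlt : (Nat.minFac n : ℝ) < x ^ (1 / V) := not_le.mp h
    have hmf0 : (0 : ℝ) < (Nat.minFac n : ℝ) := by exact_mod_cast Nat.minFac_pos n
    rw [div_le_iff₀ hL, ← Real.log_rpow hx0]
    exact Real.log_le_log hmf0 hlt.le

/-- The rough cell as a `P_s`-sum of the sharp indicator. [folklore] -/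
theorem roughCell_eq_sum_ite (A : SieveSequence) (s : ℕ) (V x : ℝ) :
    roughCell A s V x = ∑ n ∈ Ps s x, A.a n * (if x ^ (1 / V) ≤ (Nat.minFac n : ℝ) then (1 : ℝ) else 0) := by
  rw [roughCell, Finset.sum_filter]
  refine Finset.sum_congr rfl fun n _ => ?_
  split_ifs <;> simp

/-- `C_s(x, V) ≤ ∑_{n ∈ P_s(x)} a_n W_r(n)` under the hypotheses of the upper sandwich. [folklore] -/
theorem roughCell_le_sum_primeProd (A : SieveSequence) (s : ℕ) {r : ℝ → ℝ} (hr0 : ∀ t, 0 ≤ r t)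
    {V : ℝ} (hr1 : ∀ t, 1 / V ≤ t → r t = 1) {x : ℝ} (hx : 1 < x) :
    roughCell A s V x ≤ ∑ n ∈ Ps s x, A.a n * ∏ p ∈ n.primeFactors, r (Real.log p / Real.log x) := by
  rw [roughCell_eq_sum_ite]
  exact Finset.sum_le_sum fun n _ => mul_le_mul_of_nonneg_left (cellInd_le_primeProd hr0 hr1 hx n)
    (A.a_nonneg n)

/-- `∑_{n ∈ P_s(x)} a_n W_r(n) ≤ C_s(x, V)` under the hypotheses of the lower sandwich (`s ≥ 1`).
[folklore] -/
theorem sum_primeProd_le_roughCell (A : SieveSequence) {s : ℕ} (hs : 1 ≤ s) {r : ℝ → ℝ}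
    (hr0 : ∀ t, 0 ≤ r t) (hr1 : ∀ t, r t ≤ 1) {V : ℝ} (hrz : ∀ t, t ≤ 1 / V → r t = 0) {x : ℝ}
    (hx : 1 < x) :
    ∑ n ∈ Ps s x, A.a n * ∏ p ∈ n.primeFactors, r (Real.log p / Real.log x) ≤ roughCell A s V x := by
  rw [roughCell_eq_sum_ite]
  refine Finset.sum_le_sum fun n hn => mul_le_mul_of_nonneg_left
    (primeProd_le_cellInd hr0 hr1 hrz hx (two_le_of_mem hs hn)) (A.a_nonneg n)

/-! ### Alladi's theorem for the integers in the format of `roughCell` -/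

/-- `Ω(n) = #(prime factors)` for squarefree `n`. [folklore] -/
theorem cardFactors_eq_card_primeFactors {n : ℕ} (hn : n ≠ 0) (hsq : Squarefree n) :
    Ω n = n.primeFactors.card := by
  rw [← (cardDistinctFactors_eq_cardFactors_iff_squarefree hn).mpr hsq, cardDistinctFactors_apply,
    ← List.card_toFinset, Nat.toFinset_factors]

/-- A squarefree integer with `Ω = s ≥ 1` all of whose prime factors are `≥ ⌈Y⌉` lies in the cell.
Conversely the rough integers with `Ω = s` outside the cell are not squarefree. [folklore] -/
theorem card_roughIcc_filter_sub_le {s : ℕ} (hs : 1 ≤ s) {x Y : ℝ} (hx : 0 ≤ x) (hY : 1 ≤ Y) :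
    (((roughIcc ⌈Y⌉₊ ⌊x⌋₊).filter (fun b => Ω b = s)).card : ℝ) -
        ((Ps s x).filter (fun n : ℕ => Y ≤ (Nat.minFac n : ℝ))).card ≤
      2 * x / Y ∧
    (Ps s x).filter (fun n : ℕ => Y ≤ (Nat.minFac n : ℝ)) ⊆
      (roughIcc ⌈Y⌉₊ ⌊x⌋₊).filter (fun b => Ω b = s) := by
  classical
  set N := ⌊x⌋₊ with hN
  set M := ⌈Y⌉₊ with hM
  have hM1 : 1 ≤ M := Nat.ceil_pos.mpr (by linarith)
  set D₁ := (roughIcc M N).filter (fun b => Ω b = s) with hD₁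
  set D₂ := (Ps s x).filter (fun n : ℕ => Y ≤ (Nat.minFac n : ℝ)) with hD₂
  -- `D₂ ⊆ D₁`
  have hsub : D₂ ⊆ D₁ := by
    intro n hn
    obtain ⟨hn, hmin⟩ := Finset.mem_filter.mp hn
    obtain ⟨⟨hn1, hnN⟩, hsq, hcard⟩ := mem_Ps.mp hn
    refine Finset.mem_filter.mpr ⟨mem_roughIcc.mpr ⟨⟨hn1, hnN⟩, fun p hp hpn => ?_⟩, ?_⟩
    · have h1 : (Nat.minFac n : ℝ) ≤ p := by exact_mod_cast Nat.minFac_le_of_dvd hp.two_le hpn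
      exact Nat.ceil_le.mpr (hmin.trans h1)
    · rw [cardFactors_eq_card_primeFactors (by omega) hsq, hcard]
  refine ⟨?_, hsub⟩
  -- `D₁ \ D₂` consists of non-squarefree `b ≤ N` divisible by `p²` for a prime `p ≥ M`
  set Bad := (Finset.Icc M N).biUnion (fun p => (Ioc 0 N).filter (fun b => p ^ 2 ∣ b)) with hBad
  have hdiff : D₁ \ D₂ ⊆ Bad := by
    intro b hb
    rw [Finset.mem_sdiff] at hb
    obtain ⟨hb1, hb2⟩ := hb
    obtain ⟨hbr, hΩ⟩ := Finset.mem_filter.mp hb1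
    obtain ⟨⟨hb1', hbN⟩, hrough⟩ := mem_roughIcc.mp hbr
    have hb2' : 2 ≤ b := by
      by_contra h
      have : b = 1 := by omega
      rw [this, ArithmeticFunction.cardFactors_one] at hΩ
      omega
    -- not squarefree
    have hnsq : ¬ Squarefree b := by
      intro hsq
      apply hb2
      refine Finset.mem_filter.mpr ⟨mem_Ps.mpr ⟨⟨hb1', hbN⟩, hsq, ?_⟩, ?_⟩
      · rw [← hΩ, cardFactors_eq_card_primeFactors (by omega) hsq]
      · have hmfp : (Nat.minFac b).Prime := Nat.minFac_prime (by omega)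
        have h := hrough _ hmfp (Nat.minFac_dvd b)
        exact (Nat.le_ceil Y).trans (by exact_mod_cast h)
    obtain ⟨p, hp, hpb⟩ : ∃ p : ℕ, p.Prime ∧ p * p ∣ b := by
      by_contra h
      push Not at h
      exact hnsq (Nat.squarefree_iff_prime_squarefree.mpr fun p hp => h p hp)
    have hpb' : p ∣ b := dvd_trans (dvd_mul_right p p) hpb
    have hMp : M ≤ p := hrough p hp hpb'
    have hpN : p ≤ N := (Nat.le_of_dvd (by omega) hpb').trans hbN
    refine Finset.mem_biUnion.mpr ⟨p, Finset.mem_Icc.mpr ⟨hMp, hpN⟩, ?_⟩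
    exact Finset.mem_filter.mpr ⟨Finset.mem_Ioc.mpr ⟨by omega, hbN⟩, by rwa [sq]⟩
  -- counting `Bad`
  have hBadcard : (Bad.card : ℝ) ≤ 2 * x / Y := by
    have h1 : (Bad.card : ℝ) ≤ ∑ p ∈ Finset.Icc M N, (((Ioc 0 N).filter (fun b => p ^ 2 ∣ b)).card : ℝ) := by
      exact_mod_cast Finset.card_biUnion_le
    have h2 : ∀ p ∈ Finset.Icc M N, (((Ioc 0 N).filter (fun b => p ^ 2 ∣ b)).card : ℝ) ≤
        (N : ℝ) * ((p : ℝ) ^ 2)⁻¹ := by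
      intro p hp
      have hpM : 1 ≤ p := hM1.trans (Finset.mem_Icc.mp hp).1
      rw [Nat.Ioc_filter_dvd_card_eq_div, ← div_eq_mul_inv]
      have hp2 : (0 : ℝ) < (p : ℝ) ^ 2 := by positivity
      rw [le_div_iff₀ hp2]
      exact_mod_cast Nat.div_mul_le_self N (p ^ 2)
    have h3 : ∑ p ∈ Finset.Icc M N, (N : ℝ) * ((p : ℝ) ^ 2)⁻¹ ≤ (N : ℝ) * (2 / M) := by
      rw [← Finset.mul_sum]
      refine mul_le_mul_of_nonneg_left ?_ (Nat.cast_nonneg N)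
      have hI : Finset.Icc M N = Finset.Ioo (M - 1) (N + 1) := by
        ext p; simp only [Finset.mem_Icc, Finset.mem_Ioo]; omega
      rw [hI]
      have h := sum_Ioo_inv_sq_le (α := ℝ) (M - 1) (N + 1)
      have hM' : ((M - 1 : ℕ) : ℝ) + 1 = M := by
        rw [Nat.cast_sub hM1]; push_cast; ring
      rwa [hM'] at h
    have hY0 : 0 < Y := by linarith
    have hMY : Y ≤ M := Nat.le_ceil Y
    have hM0 : (0 : ℝ) < M := by exact_mod_cast hM1
    calc (Bad.card : ℝ) ≤ (N : ℝ) * (2 / M) := h1.trans ((Finset.sum_le_sum h2).trans h3)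
      _ ≤ x * (2 / Y) := mul_le_mul (Nat.floor_le hx) (div_le_div_of_nonneg_left zero_le_two hY0 hMY)
          (by positivity) hx
      _ = 2 * x / Y := by ring
  have hcard : ((D₁.card : ℕ) : ℝ) - D₂.card = ((D₁ \ D₂).card : ℕ) := by
    rw [Finset.card_sdiff_of_subset hsub, Nat.cast_sub (Finset.card_le_card hsub)]
  rw [hcard]
  exact le_trans (by exact_mod_cast Finset.card_le_card hdiff) hBadcard

/-- **Alladi's theorem for the integers, `roughCell` format**: for `s ≥ 1`, `V > 1`,
`#{n ≤ x : n squarefree, ω(n) = s, p_min(n) ≥ x^{1/V}} = I_s(V) x/log x + o(x/log x)`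
(tree: `exists_abs_roughCell_sub_main_le`, [Alladi1982] Theorem 1; the non-squarefree rough integers are
`O(x^{1−1/V})`, and for `s = 1` the subtracted `Y/log Y = V x^{1/V}/log x` is `o(x/log x)`).
[cite: Alladi1982, Theorem 1] -/
theorem roughCell_integers {s : ℕ} (hs : 1 ≤ s) {V : ℝ} (hV : 1 < V) :
    (fun x : ℝ => roughCell SieveSequence.integers s V x - roughCellDensity s V * (x / Real.log x))
      =o[atTop] fun x : ℝ => x / Real.log x := by
  obtain ⟨C, hC0, hC⟩ := exists_abs_roughCell_sub_main_le (s - 1) (⌈V⌉₊ + 1)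
  have hV0 : 0 < V := by linarith
  have hk : V ≤ ((⌈V⌉₊ + 1 : ℕ) : ℝ) := by push_cast; linarith [Nat.le_ceil V]
  rw [isLittleO_iff]
  intro c hc
  -- eventual smallness of the three error terms
  have hY2 : ∀ᶠ x : ℝ in atTop, 2 ≤ x ^ (1 / V) :=
    (tendsto_rpow_atTop (by positivity : (0 : ℝ) < 1 / V)).eventually_ge_atTop 2
  have hE1 : ∀ᶠ x : ℝ in atTop, C * V ^ 2 * x / Real.log x ^ 2 ≤ c / 3 * (x / Real.log x) := by
    filter_upwards [Real.tendsto_log_atTop.eventually_ge_atTop (3 * C * V ^ 2 / c),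
      eventually_gt_atTop (1 : ℝ)] with x hx hx1
    have hL : 0 < Real.log x := Real.log_pos hx1
    have hL0 : Real.log x ≠ 0 := hL.ne'
    have hx0 : 0 < x := by linarith
    rw [show C * V ^ 2 * x / Real.log x ^ 2 = (C * V ^ 2 / Real.log x) * (x / Real.log x) by
      field_simp]
    refine mul_le_mul_of_nonneg_right ?_ (by positivity)
    rw [div_le_iff₀ hL]
    rw [div_le_iff₀ hc] at hx
    linarith
  have hE2 : ∀ᶠ x : ℝ in atTop, V * x ^ (1 / V) / Real.log x ≤ c / 3 * (x / Real.log x) := by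
    have ht : Tendsto (fun x : ℝ => x ^ (1 - 1 / V)) atTop atTop :=
      tendsto_rpow_atTop (by rw [sub_pos, div_lt_one hV0]; exact hV)
    filter_upwards [ht.eventually_ge_atTop (3 * V / c), eventually_gt_atTop (1 : ℝ)] with x hx hx1
    have hL : 0 < Real.log x := Real.log_pos hx1
    have hx0 : 0 < x := by linarith
    rw [div_le_iff₀ hL, show c / 3 * (x / Real.log x) * Real.log x = c / 3 * x by field_simp]
    have hsplit : x = x ^ (1 / V) * x ^ (1 - 1 / V) := by
      rw [← Real.rpow_add hx0]; norm_num
    rw [div_le_iff₀ hc] at hx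
    have hp : 0 < x ^ (1 / V) := Real.rpow_pos_of_pos hx0 _
    calc V * x ^ (1 / V) = x ^ (1 / V) * V := mul_comm _ _
      _ ≤ x ^ (1 / V) * (c / 3 * x ^ (1 - 1 / V)) := mul_le_mul_of_nonneg_left (by linarith) hp.le
      _ = c / 3 * (x ^ (1 / V) * x ^ (1 - 1 / V)) := by ring
      _ = c / 3 * x := by rw [← hsplit]
  have hE3 : ∀ᶠ x : ℝ in atTop, 2 * x / x ^ (1 / V) ≤ c / 3 * (x / Real.log x) := by
    have ho := (isLittleO_log_rpow_atTop (by positivity : (0 : ℝ) < 1 / V)).def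
      (show 0 < c / 6 by positivity)
    filter_upwards [ho, eventually_gt_atTop (1 : ℝ)] with x hx hx1
    have hL : 0 < Real.log x := Real.log_pos hx1
    have hx0 : 0 < x := by linarith
    have hp : 0 < x ^ (1 / V) := Real.rpow_pos_of_pos hx0 _
    rw [Real.norm_eq_abs, Real.norm_eq_abs, abs_of_pos hL, abs_of_pos hp] at hx
    rw [div_le_iff₀ hp, show c / 3 * (x / Real.log x) * x ^ (1 / V) = (c / 3 * x) * (x ^ (1 / V) / Real.log x)
      by field_simp]
    have h1 : 2 ≤ (c / 3) * (x ^ (1 / V) / Real.log x) := by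
      rw [mul_div_assoc', le_div_iff₀ hL]; linarith
    calc 2 * x = x * 2 := mul_comm _ _
      _ ≤ x * ((c / 3) * (x ^ (1 / V) / Real.log x)) := mul_le_mul_of_nonneg_left h1 hx0.le
      _ = _ := by ring
  filter_upwards [hY2, hE1, hE2, hE3, eventually_gt_atTop (1 : ℝ)] with x hxY hx1' hx2' hx3' hx1
  have hx0 : 0 < x := by linarith
  have hL : 0 < Real.log x := Real.log_pos hx1
  set Y : ℝ := x ^ (1 / V) with hYdef
  have hY1 : 1 ≤ Y := by linarith
  have hYx : Y ≤ x := by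
    have h := Real.rpow_le_rpow_of_exponent_le hx1.le (show 1 / V ≤ 1 by rw [div_le_one hV0]; exact hV.le)
    rwa [Real.rpow_one] at h
  have hlogY : Real.log Y = Real.log x / V := by
    rw [hYdef, Real.log_rpow hx0]; ring
  have hlogXY : Real.log x ≤ ((⌈V⌉₊ + 1 : ℕ) : ℝ) * Real.log Y := by
    rw [hlogY]
    calc Real.log x = V * (Real.log x / V) := by field_simp
      _ ≤ ((⌈V⌉₊ + 1 : ℕ) : ℝ) * (Real.log x / V) :=
          mul_le_mul_of_nonneg_right hk (div_nonneg hL.le hV0.le)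
  have hA := hC x Y hxY hYx hlogXY
  have hratio : Real.log x / Real.log Y = V := by rw [hlogY]; field_simp
  rw [hratio, show s - 1 + 1 = s by omega] at hA
  obtain ⟨hdiff, _⟩ := card_roughIcc_filter_sub_le hs hx0.le hY1
  have hcell : roughCell SieveSequence.integers s V x =
      (((Ps s x).filter (fun n : ℕ => Y ≤ (Nat.minFac n : ℝ))).card : ℝ) := by
    simp only [roughCell, SieveSequence.integers_a, Finset.sum_const, nsmul_eq_mul, mul_one]
    rfl
  have hsub' := (card_roughIcc_filter_sub_le hs hx0.le hY1).2
  have hdiff0 : 0 ≤ (((roughIcc ⌈Y⌉₊ ⌊x⌋₊).filter (fun b => Ω b = s)).card : ℝ) -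
      ((Ps s x).filter (fun n : ℕ => Y ≤ (Nat.minFac n : ℝ))).card := by
    have := Finset.card_le_card hsub'
    exact sub_nonneg.mpr (by exact_mod_cast this)
  rw [Real.norm_eq_abs, Real.norm_eq_abs, abs_of_nonneg (div_nonneg hx0.le hL.le), hcell]
  -- the `[s = 1]` term
  have hind : |(if s - 1 = 0 then Y / Real.log Y else 0 : ℝ)| ≤ c / 3 * (x / Real.log x) := by
    split_ifs
    · rw [abs_of_nonneg (div_nonneg (by linarith) (by rw [hlogY]; positivity)), hlogY, div_div_eq_mul_div,
        mul_comm]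
      exact hx2'
    · rw [abs_zero]; positivity
  have hmain : |x * roughCellDensity s V / Real.log x - roughCellDensity s V * (x / Real.log x)| = 0 := by
    rw [abs_eq_zero]; ring
  have herr : C * x / Real.log Y ^ 2 = C * V ^ 2 * x / Real.log x ^ 2 := by
    rw [hlogY]; field_simp
  rw [herr] at hA
  -- triangle inequality
  have key : |((((Ps s x).filter (fun n : ℕ => Y ≤ (Nat.minFac n : ℝ))).card : ℕ) : ℝ) -
      roughCellDensity s V * (x / Real.log x)| ≤
      2 * x / Y + C * V ^ 2 * x / Real.log x ^ 2 + c / 3 * (x / Real.log x) := by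
    have e : ((((Ps s x).filter (fun n : ℕ => Y ≤ (Nat.minFac n : ℝ))).card : ℕ) : ℝ) -
        roughCellDensity s V * (x / Real.log x) =
        -((((roughIcc ⌈Y⌉₊ ⌊x⌋₊).filter (fun b => Ω b = s)).card : ℝ) -
            ((Ps s x).filter (fun n : ℕ => Y ≤ (Nat.minFac n : ℝ))).card) +
        ((((roughIcc ⌈Y⌉₊ ⌊x⌋₊).filter (fun b => Ω b = s)).card : ℝ) -
          (x * roughCellDensity s V / Real.log x - if s - 1 = 0 then Y / Real.log Y else 0)) -
        (if s - 1 = 0 then Y / Real.log Y else 0 : ℝ) +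
        (x * roughCellDensity s V / Real.log x - roughCellDensity s V * (x / Real.log x)) := by ring
    rw [e]
    refine (abs_add_le _ _).trans ?_
    rw [hmain, add_zero]
    refine (abs_sub _ _).trans ?_
    refine add_le_add ((abs_add_le _ _).trans (add_le_add ?_ hA)) hind
    rw [abs_neg, abs_of_nonneg hdiff0]
    exact hdiff
  linarith

end BombieriPr

end Literature.NumberTheory.Sieve


namespace Literature.NumberTheory.Sieve

open BombieriVector BombieriP2 BombieriRoughCells

namespace BombieriPr

/-! ### The rough cells of a Bombieri sequence -/

/-- `∑_{n ∈ P_s(x)} a_n W(n)` for the integers is `∑_{n ∈ P_s(x)} W(n)`. [folklore] -/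
theorem sum_integers_eq (s : ℕ) (x : ℝ) (W : ℕ → ℝ) :
    ∑ n ∈ Ps s x, SieveSequence.integers.a n * W n = ∑ n ∈ Ps s x, W n :=
  Finset.sum_congr rfl fun n _ => by rw [SieveSequence.integers_a, one_mul]

/-- The rough cell is nonnegative. [folklore] -/
theorem roughCell_nonneg (A : SieveSequence) (s : ℕ) (V x : ℝ) : 0 ≤ roughCell A s V x :=
  Finset.sum_nonneg fun n _ => A.a_nonneg n

/-- The real-variable core of the cell estimate: the sandwich inequalities, the comparison with the
integers, Alladi's estimates, and the size/sign information on the main terms combine to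
`|Cell − I M| ≤ c A`. [folklore] -/
theorem cell_estimate_core
    {Cell SAp SAm SIp SIm CIp CIm ρ M Mι I IVp IVm A X c e1 e3 e4 e5 K Cr : ℝ}
    (hc : 0 < c) (hA : 0 ≤ A) (hI0 : 0 ≤ I) (hIp0 : 0 ≤ IVp) (hIm0 : 0 ≤ IVm)
    (he1 : 0 ≤ e1) (he1' : e1 ≤ 1) (he4 : 0 ≤ e4) (hK : 0 ≤ K)
    (ha : Cell ≤ SAp) (hb : SAm ≤ Cell) (hCell0 : 0 ≤ Cell)
    (hd1 : SIp ≤ CIp) (hd2 : CIm ≤ SIm) (hSIp0 : 0 ≤ SIp)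
    (hc1 : |SAp - ρ * SIp| ≤ c / 8 * A) (hc2 : |SAm - ρ * SIm| ≤ c / 8 * A)
    (hE1 : |CIp - IVp * X| ≤ e3 * X) (hE2 : |CIm - IVm * X| ≤ e3 * X)
    (hρ : ρ = M / Mι) (hMι : 0 < Mι)
    (hf : |ρ| * (e3 * X) ≤ Cr * e3 * A) (hg : |ρ * X - M| ≤ K * e4 * A)
    (hh1 : |M| ≤ K * A) (hh2 : -(e5 * A) ≤ M)
    (hi1 : IVp ≤ I + e1) (hi2 : I - e1 ≤ IVm) (hi3 : IVm ≤ I + e1)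
    (hbudget : e1 * K + (I + 1) * (K * e4) + Cr * e3 + c / 8 ≤ c / 2) (he5 : I * e5 ≤ c / 8) :
    |Cell - I * M| ≤ c * A := by
  have hKe : 0 ≤ K * e4 * A := by positivity
  have hcA : 0 ≤ c * A := by positivity
  have h0 : 0 ≤ e3 * X := (abs_nonneg _).trans hE1
  have hρabs : ρ * (e3 * X) ≤ Cr * e3 * A := (mul_le_mul_of_nonneg_right (le_abs_self ρ) h0).trans hf
  have hρabs' : -(Cr * e3 * A) ≤ ρ * (e3 * X) := by
    have h1 : -(|ρ| * (e3 * X)) ≤ ρ * (e3 * X) := by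
      rw [neg_mul_eq_neg_mul]; exact mul_le_mul_of_nonneg_right (neg_abs_le ρ) h0
    linarith
  have hbudgetA : e1 * (K * A) + (I + 1) * (K * e4 * A) + Cr * e3 * A + c / 8 * A ≤ c / 2 * A := by
    have h := mul_le_mul_of_nonneg_right hbudget hA
    linarith [h, show (e1 * K + (I + 1) * (K * e4) + Cr * e3 + c / 8) * A =
      e1 * (K * A) + (I + 1) * (K * e4 * A) + Cr * e3 * A + c / 8 * A by ring]
  have hh1' : M ≤ K * A := (le_abs_self M).trans hh1
  rw [abs_le]
  constructor
  · -- lower bound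
    rcases le_or_gt 0 M with hM0 | hM0
    · have hρ0 : 0 ≤ ρ := by rw [hρ]; exact div_nonneg hM0 hMι.le
      have h1 : ρ * SIm - c / 8 * A ≤ SAm := by have := (abs_le.mp hc2).1; linarith
      have h2 : ρ * CIm ≤ ρ * SIm := mul_le_mul_of_nonneg_left hd2 hρ0
      have h3 : ρ * (IVm * X) - ρ * (e3 * X) ≤ ρ * CIm := by
        rw [← mul_sub]
        refine mul_le_mul_of_nonneg_left ?_ hρ0
        have := (abs_le.mp hE2).1; linarith
      have h4 : ρ * (IVm * X) = IVm * (ρ * X) := by ring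
      have h5 : IVm * M - IVm * (K * e4 * A) ≤ IVm * (ρ * X) := by
        rw [← mul_sub]
        refine mul_le_mul_of_nonneg_left ?_ hIm0
        have := (abs_le.mp hg).1; linarith
      have h6 : I * M - e1 * M ≤ IVm * M := by
        rw [← sub_mul]; exact mul_le_mul_of_nonneg_right hi2 hM0
      have h7 : IVm * (K * e4 * A) ≤ (I + 1) * (K * e4 * A) :=
        mul_le_mul_of_nonneg_right (by linarith) hKe
      have h8 : e1 * M ≤ e1 * (K * A) := mul_le_mul_of_nonneg_left hh1' he1
      linarith
    · have h1 : I * M ≤ 0 := mul_nonpos_of_nonneg_of_nonpos hI0 hM0.le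
      have h2 : 0 ≤ c * A := by positivity
      linarith
  · -- upper bound
    rcases le_or_gt 0 M with hM0 | hM0
    · have hρ0 : 0 ≤ ρ := by rw [hρ]; exact div_nonneg hM0 hMι.le
      have h1 : SAp ≤ ρ * SIp + c / 8 * A := by have := (abs_le.mp hc1).2; linarith
      have h2 : ρ * SIp ≤ ρ * CIp := mul_le_mul_of_nonneg_left hd1 hρ0
      have h3 : ρ * CIp ≤ ρ * (IVp * X) + ρ * (e3 * X) := by
        rw [← mul_add]
        refine mul_le_mul_of_nonneg_left ?_ hρ0
        have := (abs_le.mp hE1).2; linarith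
      have h4 : ρ * (IVp * X) = IVp * (ρ * X) := by ring
      have h5 : IVp * (ρ * X) ≤ IVp * M + IVp * (K * e4 * A) := by
        rw [← mul_add]
        refine mul_le_mul_of_nonneg_left ?_ hIp0
        have := (abs_le.mp hg).2; linarith
      have h6 : IVp * M ≤ I * M + e1 * M := by
        rw [← add_mul]; exact mul_le_mul_of_nonneg_right hi1 hM0
      have h7 : IVp * (K * e4 * A) ≤ (I + 1) * (K * e4 * A) :=
        mul_le_mul_of_nonneg_right (by linarith) hKe
      have h8 : e1 * M ≤ e1 * (K * A) := mul_le_mul_of_nonneg_left hh1' he1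
      linarith
    · have hρ0 : ρ ≤ 0 := by rw [hρ]; exact div_nonpos_of_nonpos_of_nonneg hM0.le hMι.le
      have h1 : SAp ≤ ρ * SIp + c / 8 * A := by have := (abs_le.mp hc1).2; linarith
      have h2 : ρ * SIp ≤ 0 := mul_nonpos_of_nonpos_of_nonneg hρ0 hSIp0
      have h3 : -(I * M) ≤ I * (e5 * A) := by
        rw [← mul_neg]; exact mul_le_mul_of_nonneg_left (by linarith) hI0
      have h4 : I * (e5 * A) ≤ c / 8 * A := by
        rw [← mul_assoc]; exact mul_le_mul_of_nonneg_right he5 hA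
      have h5 : 0 ≤ c * A := by positivity
      linarith

/-- **The rough `P_s`-cells of a Bombieri sequence.** If `A` satisfies Bombieri's (A₁)–(A₅) with
density constant `H`, then for every `s ≥ 1` and every depth `V > 1`,
`C_s(x, V) = ∑_{n ≤ x, n squarefree, ω(n) = s, p_min(n) ≥ x^{1/V}} a_n = I_s(V) M_s(x) + o(A(x)/log x)`,
`M_s(x) = (1 + (−1)^s) H A(x)/log x − (−1)^s ∑_{p ≤ x} a_p`, `I_s = roughCellDensity s` — under the
hypothesis `Bombieri1976_asymptotic_sieve_vector` (a theorem of the tree). Proof: sandwich the sharp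
cell between the ramp product weights `W_{r±}`, compare those with the integers (`cmp_cont`), use
Alladi's theorem for the integers at `V ± ρ'` (`roughCell_integers`), the prime number theorem
`M_s(ℤ; x) ∼ x/log x`, the continuity of `I_s` at `V`, and `M_s(A; x) ≥ −o(A/log x)`.
[cite: BombieriRIMS1977, p. 5 Theorem] -/
theorem roughCell_law (hV : Bombieri1976_asymptotic_sieve_vector) {A : SieveSequence} {H : ℝ}
    (hA : A.IsBombieriSequence) (hH : A.HasDensityConstant H) {s : ℕ} (hs : 1 ≤ s) {V : ℝ}
    (hV1 : 1 < V) :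
    (fun x : ℝ => roughCell A s V x - roughCellDensity s V * mainTerm A H s x) =o[atTop]
      fun x : ℝ => A.size x / Real.log x := by
  have hXnn : ∀ y, 0 ≤ A.size y := SieveSequence.size_nonneg_of_size_eq hA.1
  obtain ⟨K₃, hK₃0, hK₃⟩ := abs_mainTerm_eventually hA hH s
  obtain ⟨Cρ, hCρ0, hCρ⟩ := abs_mainTerm_div_le hA hH s
  set I : ℝ := roughCellDensity s V with hI
  have hI0 : 0 ≤ I := roughCellDensity_nonneg s V
  have hV0 : 0 < V := by linarith
  rw [isLittleO_iff]
  intro c hc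
  -- (1) the continuity window
  set ε₁ : ℝ := min 1 (c / (8 * (K₃ + 1))) with hε₁
  have hε₁0 : 0 < ε₁ := lt_min one_pos (by positivity)
  have hε₁1 : ε₁ ≤ 1 := min_le_left _ _
  have hε₁K : ε₁ * K₃ ≤ c / 8 := by
    calc ε₁ * K₃ ≤ c / (8 * (K₃ + 1)) * K₃ := mul_le_mul_of_nonneg_right (min_le_right _ _) hK₃0
      _ = c / 8 * (K₃ / (K₃ + 1)) := by field_simp
      _ ≤ c / 8 * 1 := by
          refine mul_le_mul_of_nonneg_left ?_ (by positivity)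
          rw [div_le_one (by positivity)]; linarith
      _ = c / 8 := mul_one _
  obtain ⟨δ, hδ0, hδ⟩ := Metric.continuousAt_iff.mp (continuousAt_roughCellDensity s hV1) ε₁ hε₁0
  set ρ' : ℝ := min (δ / 2) ((V - 1) / 2) with hρ'
  have hρ'0 : 0 < ρ' := lt_min (by linarith) (by linarith)
  have hρ'δ : ρ' < δ := lt_of_le_of_lt (min_le_left _ _) (by linarith)
  have hρ'V : ρ' ≤ (V - 1) / 2 := min_le_right _ _
  set Vp : ℝ := V + ρ' with hVp
  set Vm : ℝ := V - ρ' with hVm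
  have hVm1 : 1 < Vm := by rw [hVm]; linarith
  have hVm0 : 0 < Vm := by linarith
  have hVmV : Vm < V := by rw [hVm]; linarith
  have hVVp : V < Vp := by rw [hVp]; linarith
  have hVp1 : 1 < Vp := by linarith
  have hVp0 : 0 < Vp := by linarith
  have hIVp : |roughCellDensity s Vp - I| < ε₁ := by
    have h := hδ (x := Vp) (by rw [Real.dist_eq, hVp, add_sub_cancel_left, abs_of_pos hρ'0]; exact hρ'δ)
    rwa [Real.dist_eq] at h
  have hIVm : |roughCellDensity s Vm - I| < ε₁ := by
    have h := hδ (x := Vm) (by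
      rw [Real.dist_eq, hVm, show V - ρ' - V = -ρ' by ring, abs_neg, abs_of_pos hρ'0]; exact hρ'δ)
    rwa [Real.dist_eq] at h
  -- (2) the two ramps
  have hθp : 0 < 1 / V - 1 / Vp := by rw [sub_pos]; exact one_div_lt_one_div_of_lt hV0 hVVp
  set rp : ℝ → ℝ := ramp (1 / Vp) (1 / V - 1 / Vp) with hrp
  have hrp0 : ∀ t, 0 ≤ rp t := fun t => ramp_nonneg _ _ _
  have hrp1 : ∀ t, rp t ≤ 1 := fun t => ramp_le_one _ _ _
  have hrp_zero : ∀ t, t ≤ 1 / Vp → rp t = 0 := fun t ht => ramp_eq_zero hθp ht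
  have hrp_one : ∀ t, 1 / V ≤ t → rp t = 1 := fun t ht => ramp_eq_one hθp (by linarith)
  have hθm : 0 < 1 / Vm - 1 / V := by rw [sub_pos]; exact one_div_lt_one_div_of_lt hVm0 hVmV
  set rm : ℝ → ℝ := ramp (1 / V) (1 / Vm - 1 / V) with hrm
  have hrm0 : ∀ t, 0 ≤ rm t := fun t => ramp_nonneg _ _ _
  have hrm1 : ∀ t, rm t ≤ 1 := fun t => ramp_le_one _ _ _
  have hrm_zero : ∀ t, t ≤ 1 / V → rm t = 0 := fun t ht => ramp_eq_zero hθm ht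
  have hrm_one : ∀ t, 1 / Vm ≤ t → rm t = 1 := fun t ht => ramp_eq_one hθm (by linarith)
  -- (3) comparison with the integers for the two ramps
  have hcp := (cmp_cont hV hA hH hs (continuousOn_ramp_div_sq (by positivity : (0 : ℝ) < 1 / Vp) hθp)
    (fun t _ => ramp_eq_sq_mul (by positivity : (0 : ℝ) ≤ 1 / Vp) hθp t)).def
    (show 0 < c / 8 by positivity)
  have hcm := (cmp_cont hV hA hH hs (continuousOn_ramp_div_sq (by positivity : (0 : ℝ) < 1 / V) hθm)
    (fun t _ => ramp_eq_sq_mul (by positivity : (0 : ℝ) ≤ 1 / V) hθm t)).def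
    (show 0 < c / 8 by positivity)
  -- (4) Alladi for the integers at `Vp`, `Vm`
  set ε₃ : ℝ := c / (16 * (Cρ + 1)) with hε₃
  have hε₃0 : 0 < ε₃ := by positivity
  have hε₃C : Cρ * ε₃ ≤ c / 16 := by
    rw [hε₃, mul_div_assoc', div_le_div_iff₀ (by positivity) (by norm_num)]
    nlinarith
  have hAp := (roughCell_integers hs hVp1).def hε₃0
  have hAm := (roughCell_integers hs hVm1).def hε₃0
  -- (5) `(x/log x)/M_s(ℤ;x) → 1`
  set ε₄ : ℝ := c / (8 * (K₃ + 1) * (I + 1)) with hε₄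
  have hε₄0 : 0 < ε₄ := by positivity
  have hε₄K : (I + 1) * (K₃ * ε₄) ≤ c / 8 := by
    rw [hε₄, show (I + 1) * (K₃ * (c / (8 * (K₃ + 1) * (I + 1)))) = c / 8 * (K₃ / (K₃ + 1)) by
      field_simp]
    calc c / 8 * (K₃ / (K₃ + 1)) ≤ c / 8 * 1 := by
          refine mul_le_mul_of_nonneg_left ?_ (by positivity)
          rw [div_le_one (by positivity)]; linarith
      _ = c / 8 := mul_one _
  have hinv := (tendsto_mainTerm_integers s).inv₀ one_ne_zero
  rw [inv_one] at hinv
  have hρx := hinv.eventually (Metric.ball_mem_nhds (1 : ℝ) hε₄0)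
  -- (6) the sign of `M_s(A; x)`
  have hneg := mainTerm_ge hA hH s (ε := c / (8 * (I + 1))) (by positivity)
  have hε₅ : I * (c / (8 * (I + 1))) ≤ c / 8 := by
    rw [mul_div_assoc', div_le_div_iff₀ (by positivity) (by norm_num)]
    nlinarith
  have hbudget : ε₁ * K₃ + (I + 1) * (K₃ * ε₄) + Cρ * ε₃ + c / 8 ≤ c / 2 := by linarith
  filter_upwards [hK₃, hCρ, hcp, hcm, hAp, hAm, hρx, hneg, mainTerm_integers_pos s,
    eventually_gt_atTop (1 : ℝ)] with x hxK hxρ hxcp hxcm hxAp hxAm hxinv hxneg hMpos hx1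
  have hx0 : 0 < x := by linarith
  have hL : 0 < Real.log x := Real.log_pos hx1
  have hAL : 0 ≤ A.size x / Real.log x := div_nonneg (hXnn x) hL.le
  have hxL : 0 ≤ x / Real.log x := div_nonneg hx0.le hL.le
  rw [Real.norm_eq_abs, Real.norm_eq_abs, abs_of_nonneg hAL]
  rw [Real.norm_eq_abs, Real.norm_eq_abs, abs_of_nonneg hAL] at hxcp hxcm
  rw [Real.norm_eq_abs, Real.norm_eq_abs, abs_of_nonneg hxL] at hxAp hxAm
  -- the inputs of the core estimate
  have hMι0 : 0 < mainTerm SieveSequence.integers 1 s x := hMpos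
  have hg0 : |(x / Real.log x) / mainTerm SieveSequence.integers 1 s x - 1| < ε₄ := by
    have h : dist ((mainTerm SieveSequence.integers 1 s x * Real.log x / x)⁻¹) 1 < ε₄ := hxinv
    rw [Real.dist_eq] at h
    have e : (mainTerm SieveSequence.integers 1 s x * Real.log x / x)⁻¹ =
        (x / Real.log x) / mainTerm SieveSequence.integers 1 s x := by
      rw [inv_div, div_div, mul_comm (Real.log x)]
    rwa [e] at h
  have hg : |(mainTerm A H s x / mainTerm SieveSequence.integers 1 s x) * (x / Real.log x) - mainTerm A H s x| ≤
      K₃ * ε₄ * (A.size x / Real.log x) := by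
    have e : (mainTerm A H s x / mainTerm SieveSequence.integers 1 s x) * (x / Real.log x) - mainTerm A H s x =
        mainTerm A H s x * ((x / Real.log x) / mainTerm SieveSequence.integers 1 s x - 1) := by
      rw [mul_sub, mul_one, div_mul_eq_mul_div, mul_div_assoc]
    rw [e, abs_mul]
    calc |mainTerm A H s x| * |(x / Real.log x) / mainTerm SieveSequence.integers 1 s x - 1|
        ≤ (K₃ * A.size x / Real.log x) * ε₄ :=
          mul_le_mul hxK hg0.le (abs_nonneg _) (by have := hXnn x; positivity)
      _ = K₃ * ε₄ * (A.size x / Real.log x) := by ring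
  have hf : |(mainTerm A H s x / mainTerm SieveSequence.integers 1 s x)| * (ε₃ * (x / Real.log x)) ≤ Cρ * ε₃ * (A.size x / Real.log x) := by
    calc |(mainTerm A H s x / mainTerm SieveSequence.integers 1 s x)| * (ε₃ * (x / Real.log x)) ≤ Cρ * (A.size x / x) * (ε₃ * (x / Real.log x)) :=
          mul_le_mul_of_nonneg_right hxρ (by positivity)
      _ = Cρ * ε₃ * (A.size x / Real.log x) := by
          field_simp
  have hh1 : |mainTerm A H s x| ≤ K₃ * (A.size x / Real.log x) := by rw [← mul_div_assoc]; exact hxK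
  exact cell_estimate_core hc hAL hI0 (roughCellDensity_nonneg s Vp) (roughCellDensity_nonneg s Vm)
    hε₁0.le hε₁1 hε₄0.le hK₃0
    (roughCell_le_sum_primeProd A s hrp0 hrp_one hx1)
    (sum_primeProd_le_roughCell A hs hrm0 hrm1 hrm_zero hx1) (roughCell_nonneg A s V x)
    (by have h := sum_primeProd_le_roughCell SieveSequence.integers hs hrp0 hrp1 hrp_zero (V := Vp) hx1
        rwa [sum_integers_eq] at h)
    (by have h := roughCell_le_sum_primeProd SieveSequence.integers s hrm0 (V := Vm) hrm_one hx1
        rwa [sum_integers_eq] at h)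
    (Finset.sum_nonneg fun n _ => primeProd_nonneg hrp0 x n)
    hxcp hxcm hxAp hxAm rfl hMι0 hf hg hh1 hxneg
    (by have := (abs_lt.mp hIVp).2; linarith) (by have := (abs_lt.mp hIVm).1; linarith)
    (by have := (abs_lt.mp hIVm).2; linarith) hbudget hε₅

end BombieriPr

end Literature.NumberTheory.Sieve

end
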